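import Summits.Ventures.PercRepro.RankLevelSetUpColoop
import Summits.Ventures.PercRepro.RankLevelSetThroughMinorPair

/-! # RankLevelSetUpPairColoop — THE COLOOP REDUCTION OF THE PAIR (↑) (night-1 g40; dossier §52.16; on
`RankLevelSetUpColoop` and `RankLevelSetThroughMinorPair`)

For a coloop `c ∉ {b, b'}` the through-`{b,b'}` and avoid-`{b,b'}` counts of `M` are the sums of those of `M ＼ c` at
two consecutive levels (**`throughPair_ncard_of_isColoop`**, **`avoidPair_ncard_of_isColoop`**: the members not
containing `c` are those of `M ＼ c`, those containing `c` are `insert c` of the members of `M ＼ c` one level down —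
`mem_biIndep_delete_iff_of_notMem`, `mem_biIndep_iff_sdiff_of_mem`), so the pair (↑) at level `k + 1` for `M`
follows from the pair (↑) at the levels `k + 1` and `k` for `M ＼ c` (**`upPairAt_of_isColoop`**). Every
declaration has a docstring; imports: the cell's own modules and Mathlib only. Axioms: standard. -/

namespace PercRepro

open Set Matroid

variable {α : Type} (M : Matroid α) [M.Finite]

/-- **THE THROUGH-`{b,b'}` COUNT ACROSS A COLOOP** (`c ∉ {b, b'}`): `T^{bb'}_{k+1}(M) = T^{bb'}_{k+1}(M ＼ c) + T^{bb'}_k(M ＼ c)`. -/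
lemma throughPair_ncard_of_isColoop {c : α} (hc : M.IsColoop c) {b b' : α} (hbc : b ≠ c) (hb'c : b' ≠ c) (k : ℕ) :
    {W ∈ biIndep M (k + 1) | b ∈ W ∧ b' ∈ W}.ncard =
      {W ∈ biIndep (M.delete {c}) (k + 1) | b ∈ W ∧ b' ∈ W}.ncard +
        {W ∈ biIndep (M.delete {c}) k | b ∈ W ∧ b' ∈ W}.ncard := by
  classical
  haveI : (M.delete {c}).Finite := ⟨M.ground_finite.subset Set.sdiff_subset⟩
  have hsplit : {W ∈ biIndep M (k + 1) | b ∈ W ∧ b' ∈ W} =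
      {W ∈ biIndep M (k + 1) | (b ∈ W ∧ b' ∈ W) ∧ c ∉ W} ∪ {W ∈ biIndep M (k + 1) | (b ∈ W ∧ b' ∈ W) ∧ c ∈ W} := by
    ext W; simp only [Set.mem_union, Set.mem_setOf_eq]; tauto
  have hdisj : Disjoint {W ∈ biIndep M (k + 1) | (b ∈ W ∧ b' ∈ W) ∧ c ∉ W}
      {W ∈ biIndep M (k + 1) | (b ∈ W ∧ b' ∈ W) ∧ c ∈ W} := by
    rw [Set.disjoint_left]; rintro W ⟨-, -, h1⟩ ⟨-, -, h2⟩; exact h1 h2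
  have hfin1 : {W ∈ biIndep M (k + 1) | (b ∈ W ∧ b' ∈ W) ∧ c ∉ W}.Finite :=
    (biIndep_finite M _).subset (fun _ h => h.1)
  have hfin2 : {W ∈ biIndep M (k + 1) | (b ∈ W ∧ b' ∈ W) ∧ c ∈ W}.Finite :=
    (biIndep_finite M _).subset (fun _ h => h.1)
  rw [hsplit, Set.ncard_union_eq hdisj hfin1 hfin2]
  congr 1
  · refine Set.ncard_congr (fun W _ => W) ?_ ?_ ?_
    · rintro W ⟨hW, hbW, hcW⟩
      exact ⟨(mem_biIndep_delete_iff_of_notMem M hc hcW).mp hW, hbW⟩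
    · intro W W' _ _ h; exact h
    · rintro W ⟨hW, hbW⟩
      have hcW : c ∉ W := fun h => (hW.1 h).2 rfl
      exact ⟨W, ⟨(mem_biIndep_delete_iff_of_notMem M hc hcW).mpr hW, hbW, hcW⟩, rfl⟩
  · refine Set.ncard_congr (fun W _ => W \ {c}) ?_ ?_ ?_
    · rintro W ⟨hW, ⟨hbW, hb'W⟩, hcW⟩
      exact ⟨(mem_biIndep_iff_sdiff_of_mem M hc hcW).mp hW, ⟨hbW, hbc⟩, ⟨hb'W, hb'c⟩⟩
    · rintro W W' ⟨-, -, hcW⟩ ⟨-, -, hcW'⟩ h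
      have h1 : insert c (W \ {c}) = insert c (W' \ {c}) := by rw [h]
      rwa [Set.insert_sdiff_singleton, Set.insert_sdiff_singleton, Set.insert_eq_of_mem hcW,
        Set.insert_eq_of_mem hcW'] at h1
    · rintro U ⟨hU, hbU, hb'U⟩
      have hcU : c ∉ U := fun h => (hU.1 h).2 rfl
      refine ⟨insert c U, ⟨?_, ⟨Set.mem_insert_of_mem c hbU, Set.mem_insert_of_mem c hb'U⟩, Set.mem_insert c U⟩, ?_⟩
      · rw [mem_biIndep_iff_sdiff_of_mem M hc (Set.mem_insert c U), Set.insert_sdiff_of_mem _ (Set.mem_singleton c),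
          Set.sdiff_singleton_eq_self hcU]
        exact hU
      · rw [Set.insert_sdiff_of_mem _ (Set.mem_singleton c), Set.sdiff_singleton_eq_self hcU]

/-- **THE AVOID-`{b,b'}` COUNT ACROSS A COLOOP** (`c ∉ {b, b'}`): `V^{bb'}_{k+1}(M) = V^{bb'}_{k+1}(M ＼ c) + V^{bb'}_k(M ＼ c)`. -/
lemma avoidPair_ncard_of_isColoop {c : α} (hc : M.IsColoop c) {b b' : α} (hbc : b ≠ c) (hb'c : b' ≠ c) (k : ℕ) :
    {Z ∈ biIndep M (k + 1) | b ∉ Z ∧ b' ∉ Z}.ncard =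
      {Z ∈ biIndep (M.delete {c}) (k + 1) | b ∉ Z ∧ b' ∉ Z}.ncard +
        {Z ∈ biIndep (M.delete {c}) k | b ∉ Z ∧ b' ∉ Z}.ncard := by
  classical
  haveI : (M.delete {c}).Finite := ⟨M.ground_finite.subset Set.sdiff_subset⟩
  have hsplit : {Z ∈ biIndep M (k + 1) | b ∉ Z ∧ b' ∉ Z} =
      {Z ∈ biIndep M (k + 1) | (b ∉ Z ∧ b' ∉ Z) ∧ c ∉ Z} ∪ {Z ∈ biIndep M (k + 1) | (b ∉ Z ∧ b' ∉ Z) ∧ c ∈ Z} := by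
    ext Z; simp only [Set.mem_union, Set.mem_setOf_eq]; tauto
  have hdisj : Disjoint {Z ∈ biIndep M (k + 1) | (b ∉ Z ∧ b' ∉ Z) ∧ c ∉ Z}
      {Z ∈ biIndep M (k + 1) | (b ∉ Z ∧ b' ∉ Z) ∧ c ∈ Z} := by
    rw [Set.disjoint_left]; rintro Z ⟨-, -, h1⟩ ⟨-, -, h2⟩; exact h1 h2
  have hfin1 : {Z ∈ biIndep M (k + 1) | (b ∉ Z ∧ b' ∉ Z) ∧ c ∉ Z}.Finite :=
    (biIndep_finite M _).subset (fun _ h => h.1)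
  have hfin2 : {Z ∈ biIndep M (k + 1) | (b ∉ Z ∧ b' ∉ Z) ∧ c ∈ Z}.Finite :=
    (biIndep_finite M _).subset (fun _ h => h.1)
  rw [hsplit, Set.ncard_union_eq hdisj hfin1 hfin2]
  congr 1
  · refine Set.ncard_congr (fun Z _ => Z) ?_ ?_ ?_
    · rintro Z ⟨hZ, hbZ, hcZ⟩
      exact ⟨(mem_biIndep_delete_iff_of_notMem M hc hcZ).mp hZ, hbZ⟩
    · intro Z Z' _ _ h; exact h
    · rintro Z ⟨hZ, hbZ⟩
      have hcZ : c ∉ Z := fun h => (hZ.1 h).2 rfl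
      exact ⟨Z, ⟨(mem_biIndep_delete_iff_of_notMem M hc hcZ).mpr hZ, hbZ, hcZ⟩, rfl⟩
  · refine Set.ncard_congr (fun Z _ => Z \ {c}) ?_ ?_ ?_
    · rintro Z ⟨hZ, ⟨hbZ, hb'Z⟩, hcZ⟩
      exact ⟨(mem_biIndep_iff_sdiff_of_mem M hc hcZ).mp hZ, fun h => hbZ h.1, fun h => hb'Z h.1⟩
    · rintro Z Z' ⟨-, -, hcZ⟩ ⟨-, -, hcZ'⟩ h
      have h1 : insert c (Z \ {c}) = insert c (Z' \ {c}) := by rw [h]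
      rwa [Set.insert_sdiff_singleton, Set.insert_sdiff_singleton, Set.insert_eq_of_mem hcZ,
        Set.insert_eq_of_mem hcZ'] at h1
    · rintro U ⟨hU, hbU, hb'U⟩
      have hcU : c ∉ U := fun h => (hU.1 h).2 rfl
      refine ⟨insert c U, ⟨?_, ⟨?_, ?_⟩, Set.mem_insert c U⟩, ?_⟩
      · rw [mem_biIndep_iff_sdiff_of_mem M hc (Set.mem_insert c U), Set.insert_sdiff_of_mem _ (Set.mem_singleton c),
          Set.sdiff_singleton_eq_self hcU]
        exact hU
      · rintro (h | h)
        · exact hbc h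
        · exact hbU h
      · rintro (h | h)
        · exact hb'c h
        · exact hb'U h
      · rw [Set.insert_sdiff_of_mem _ (Set.mem_singleton c), Set.sdiff_singleton_eq_self hcU]

/-- **THE PAIR (↑) AT LEVEL `k + 1` ACROSS A COLOOP `c ∉ {b, b'}`**: from the pair (↑) at the levels `k + 1` and `k`
for `M ＼ c`. -/
theorem upPairAt_of_isColoop {c : α} (hc : M.IsColoop c) {b b' : α} (hbc : b ≠ c) (hb'c : b' ≠ c) {k : ℕ}
    (h1 : BiIndepUpPairAt (M.delete {c}) b b' (k + 1)) (h2 : BiIndepUpPairAt (M.delete {c}) b b' k) :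
    BiIndepUpPairAt M b b' (k + 1) := by
  unfold BiIndepUpPairAt at h1 h2 ⊢
  rw [throughPair_ncard_of_isColoop M hc hbc hb'c k, avoidPair_ncard_of_isColoop M hc hbc hb'c (k + 1)]
  omega

end PercRepro
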